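/-
Copyright (c) 2026 the pub-hodgecm-mathlib formalisation cell (harness21).  Prover seat hodgecm-mathlib-K2Liu-p27 (g2), Track B «K2-LIT»,
#184♮ = hLiu418 = `stmt-HodgeConjecture-24832`; RULING M-158u + BATCH #133 (LEAD F0P6-plan (g14)): F4 (G-gen) B3-a = the per-place step at the FOCK
INSTANCE (F4 lead K2Liu-p27; design of record 23:26Z «polynomial-slot tuples»).
THEOREMS ONLY (no `def`, no `instance`, no notation, no named-fact hypothesis, no `sorry`); lane `--supports stmt-HodgeConjecture-24832 --as helper`.
-/
import Summits.HodgeConjecture.HodgeConjecture.Theorems.K2LiuFockPActionExport        -- ★ (E-b) file 2 (LH7-p07): `am_prodCS`, `ap_prodCR_mul_prodCS_sub_mem_span`, `binvPi_ap∕_am`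
import Summits.HodgeConjecture.HodgeConjecture.Theorems.K2LiuLocalThetaCyclicUniform   -- ★ (E-f) core + (E-c): `induction_on_kFinite`, `map_prod_mem_of_stable`
import Summits.HodgeConjecture.HodgeConjecture.Theorems.K2LiuLocalThetaReduction       -- ★ (E-d-R) (K2Liu-p26): `hRED_of_pivot` (ED. 2)
import Summits.HodgeConjecture.HodgeConjecture.Theorems.K2LiuFockInvariantsOfBlocks    -- ★ bridge part 2 (K2Liu-p23): `fft_fock_of_fft_blocks_prod` (ED. 3)
import HarnessLib

/-!
# Crux `HLiu418`, organ F4 (G-gen), B3-a: THE FOCK INSTANCE — the PBW induction and the local cyclicity AT THE JUNCTION DATUM `U(P,Q) × U(R,S)`, with the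
# (E-b)∕(E-c) letters DISCHARGED (★ `K2LiuFockPActionExport`)

Cell `hodgecm-mathlib`, crux item hLiu418 = `stmt-HodgeConjecture-24832` (helper lane `--supports`, count-neutral; closes no socket).

★ (E-c) `K2LiuFockPBWInduction` and ★ (E-f) `K2LiuLocalThetaCyclicUniform` are GENERIC in the letters (hAm)(hAp)(hBp)(hBm); ★ (E-b) file 2 `K2LiuFockPActionExport`
(LH7-p07 (g2)) proves those four letters at the Fock instance `A := MvPolynomial (DPIdx P Q R S) ℂ`, `ι := P × Q`, `CR (p,q) := Σ_r X_{(p,r)} X′_{(q,r)}`,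
`CS (p,q) := Σ_s X_{(p,s)} X′_{(q,s)}`, `Ap (p,q) := (2i∕π)·D^S_{pq} − 2πi·(C^R_{pq} ·)`, `Am (p,q) := 2πi·(C^S_{pq} ·) − (2i∕π)·D^R_{pq}` (`c₁ = −2πi`, `c₃ = 2πi`),
`B := binvPiₗ`, and the `ℂ`-linear Schwartz operators `ωp (p,q) := hypOpGenC − i·(μ₀(D_{π∕2}) ∘ hypOpGenC ∘ μ₀(D_{π∕2})⁻¹)`, `ωm (p,q) := hypOpGenC + i·(…)` (= ★
Konno–Konno `hypOpGen ∓ i·rotBoostGen (π∕2)`, the `𝔭^±` root vectors).  THIS FILE performs the instantiation once, so that downstream (B3-b, (E-f-inst)) never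
re-spells the four letters:
* §1 **`binvPi_prodCR_mul_prodCS_mem_of_stable`** — «`L⁺ ⊗ L⁻ · φ° ⊆ U(𝔭⁺ ⊕ 𝔭⁻)·φ°`» CONCRETELY: every subspace `N` of `𝓢(ℝ^{DPIdx})` containing the vacuum
  `binvPiₗ 1` and stable under the `2|P||Q|` operators `ωp`, `ωm` contains `binvPiₗ (∏_ρ C^R · ∏_τ C^S)` for all words `ρ, τ`; the span form
  `binvPi_mem_of_mem_span_balanced_of_stable`;
* §2 **`fock_induction_of_letters`** — ★ (E-f) `induction_on_kFinite` at `B := LinearMap.id` with (hAm)(hAp) DISCHARGED: for any substitution family `subst` with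
  the first fundamental theorem (FFT) and any linear section map `SW` with the reduction (RED) (the two remaining letters: bridge∕adapter and (E-d)), every
  property of Fock polynomials closed under `0, +, •`, the symbols `Ap, Am` and «same section», holding at `1`, holds everywhere — the `hlift` of ★ B3-core
  `forall_of_vacuum_of_placeLift` ∕ the per-place step of ★ `forall_tuple_of_fockLetters`, at the junction datum of one real place.
ED. 2 (the two remaining letters put in their CONSUMER currency):
* §3 **`adjoin_range_union_le_span_balanced`**, `mem_span_balanced_of_mem_adjoin` — generic: in a commutative algebra the subalgebra generated by two families
  `f, g` lies in the span of the balanced products `(∏_ρ f) · (∏_τ g)` (so an FFT landing in `Algebra.adjoin ℂ {contractions}` feeds (E-f)'s span letter);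
* §4 **`fock_induction_of_pivot`** — `P = Q = Fin 2`: (RED) DISCHARGED by ★ `K2LiuLocalThetaReduction.hRED_of_pivot` (K2Liu-p26); the per-place step with exactly
  two letters left BY VALUE: the see-saw pivot `hpiv : SW (κOp R S e (1,k) v) = vacScalar e (1,k) • SW v` (★ (P-arch) + (R-grp) + ★ SW-law + (R-scal)) and the
  first fundamental theorem `hFFT` in the `linSubst (star ↑(dualPairι (1,k)))`-invariance ∕ `Algebra.adjoin` currency of the (E-a) bricks.
ED. 3: §5 **`fock_induction_of_blockFFT_of_pivot`** — (FFT) discharged down to the two BLOCK letters `hR`, `hS` of ★ K2Liu-p23's bridge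
  `K2LiuFockInvariantsOfBlocks.fft_fock_of_fft_blocks_prod` (the `U(R)`-FFT on the `R`-block and the `U(S)`-FFT on the `S`-block, = ★ K2E1-p10
  `K2LiuUnitaryFFTContractions.isUnitaryInvariant_iff_mem_adjoin` after p23's reindex transport): per place, road (E)'s residue is `{hR, hS, hpiv}`.
References: [Folland1989, §4.2 Prop. (4.39)]; [Howe1989, §3]; [KashiwaraVergne1978, §II.5] (the file is instantiation only).
HONEST LABEL: HC_CM is proved only modulo the 7 printed citations (2 remaining named inputs: hLiu418 = stmt-HodgeConjecture-24832,
h413 = stmt-HodgeConjecture-24833) until rung 0 closes; count-neutral helper, closes no socket.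
-/

set_option autoImplicit false
set_option linter.dupNamespace false -- the mandated namespace repeats `HodgeConjecture.HodgeConjecture`

noncomputable section

open MvPolynomial Complex
open scoped Real
open Literature.Analysis.SegalBargmann
open Literature.RepresentationTheory.KonnoKonno2007.RealDualPair
open Summit.HodgeConjecture.HodgeConjecture.Cruxes.HLiu418.K2LiuFockPActionExport
open Summit.HodgeConjecture.HodgeConjecture.Cruxes.HLiu418.K2LiuFockPBWInduction
open Summit.HodgeConjecture.HodgeConjecture.Cruxes.HLiu418.K2LiuLocalThetaCyclicUniform

namespace Summit.HodgeConjecture.HodgeConjecture.Cruxes.HLiu418.K2LiuArchSWPlaceCyclic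

variable {P Q : Type*} [Fintype P] [DecidableEq P] [Fintype Q] [DecidableEq Q]
  (R S : Type*) [Fintype R] [DecidableEq R] [Fintype S] [DecidableEq S]

/-! ## §1 `L⁺ ⊗ L⁻ · φ°` lies in every `𝔭^±`-stable subspace containing the vacuum -/

/-- **THE PBW INDUCTION AT THE FOCK INSTANCE**: for every subspace `N ≤ 𝓢(ℝ^{DPIdx P Q R S})` containing the vacuum `binvPiₗ 1` and stable under the `𝔭⁺` operators
`ωp_{(p,q)} = hypOpGenC − i·(μ₀(D_{π∕2}) hypOpGenC μ₀(D_{π∕2})⁻¹)` and the `𝔭⁻` operators `ωm_{(p,q)} = hypOpGenC + i·(…)`, every balanced contraction vector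
`binvPiₗ (∏_ρ C^R_{pq} · ∏_τ C^S_{pq})` lies in `N` (★ (E-c) `map_prod_mem_of_stable` with the four letters of ★ (E-b) file 2).
[cite: Folland1989, §4.2 Prop. (4.39)] [cite: Howe1989, §3] -/
theorem binvPi_prodCR_mul_prodCS_mem_of_stable (N : Submodule ℂ (SchwartzMap (DPIdx P Q R S → ℝ) ℂ)) (h1 : binvPiₗ (1 : MvPolynomial (DPIdx P Q R S) ℂ) ∈ N)
    (hNp : ∀ (i : P × Q), ∀ v ∈ N,
      ((hypOpGenC R S i.1 i.2 : SchwartzMap (DPIdx P Q R S → ℝ) ℂ →L[ℂ] SchwartzMap (DPIdx P Q R S → ℝ) ℂ) -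
          I • ((unitaryOpPi (phaseU R S i.1 (π / 2))).comp ((hypOpGenC R S i.1 i.2).comp (unitaryOpPi (phaseU R S i.1 (π / 2))⁻¹)))) v ∈ N)
    (hNm : ∀ (i : P × Q), ∀ v ∈ N,
      ((hypOpGenC R S i.1 i.2 : SchwartzMap (DPIdx P Q R S → ℝ) ℂ →L[ℂ] SchwartzMap (DPIdx P Q R S → ℝ) ℂ) +
          I • ((unitaryOpPi (phaseU R S i.1 (π / 2))).comp ((hypOpGenC R S i.1 i.2).comp (unitaryOpPi (phaseU R S i.1 (π / 2))⁻¹)))) v ∈ N)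
    (ρ τ : List (P × Q)) :
    binvPiₗ ((ρ.map fun i : P × Q => (∑ r : R, X (Sum.inl (Sum.inl (i.1, r))) * X (Sum.inr (Sum.inr (i.2, r))) : MvPolynomial (DPIdx P Q R S) ℂ)).prod *
        (τ.map fun i : P × Q => (∑ s : S, X (Sum.inr (Sum.inl (i.1, s))) * X (Sum.inl (Sum.inr (i.2, s))) : MvPolynomial (DPIdx P Q R S) ℂ)).prod) ∈ N :=
  map_prod_mem_of_stable
    (fun i : P × Q => (∑ r : R, X (Sum.inl (Sum.inl (i.1, r))) * X (Sum.inr (Sum.inr (i.2, r))) : MvPolynomial (DPIdx P Q R S) ℂ))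
    (fun i : P × Q => (∑ s : S, X (Sum.inr (Sum.inl (i.1, s))) * X (Sum.inl (Sum.inr (i.2, s))) : MvPolynomial (DPIdx P Q R S) ℂ))
    (fun i : P × Q => ((2 * (π : ℂ)⁻¹ * I : ℂ) • (∑ s : S, pderivLin (Sum.inr (Sum.inl (i.1, s)) : DPIdx P Q R S) ∘ₗ pderivLin (Sum.inl (Sum.inr (i.2, s)))) -
          (2 * π * I : ℂ) • LinearMap.mulLeft ℂ (∑ r : R, X (Sum.inl (Sum.inl (i.1, r))) * X (Sum.inr (Sum.inr (i.2, r))) : MvPolynomial (DPIdx P Q R S) ℂ)))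
    (fun i : P × Q => ((2 * π * I : ℂ) • LinearMap.mulLeft ℂ (∑ s : S, X (Sum.inr (Sum.inl (i.1, s))) * X (Sum.inl (Sum.inr (i.2, s))) : MvPolynomial (DPIdx P Q R S) ℂ) -
        (2 * (π : ℂ)⁻¹ * I : ℂ) • ∑ r : R, pderivLin (Sum.inl (Sum.inl (i.1, r)) : DPIdx P Q R S) ∘ₗ pderivLin (Sum.inr (Sum.inr (i.2, r)))))
    binvPiₗ
    (fun i : P × Q => ((hypOpGenC R S i.1 i.2 : SchwartzMap (DPIdx P Q R S → ℝ) ℂ →L[ℂ] SchwartzMap (DPIdx P Q R S → ℝ) ℂ) -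
          I • ((unitaryOpPi (phaseU R S i.1 (π / 2))).comp ((hypOpGenC R S i.1 i.2).comp (unitaryOpPi (phaseU R S i.1 (π / 2))⁻¹)))).toLinearMap)
    (fun i : P × Q => ((hypOpGenC R S i.1 i.2 : SchwartzMap (DPIdx P Q R S → ℝ) ℂ →L[ℂ] SchwartzMap (DPIdx P Q R S → ℝ) ℂ) +
          I • ((unitaryOpPi (phaseU R S i.1 (π / 2))).comp ((hypOpGenC R S i.1 i.2).comp (unitaryOpPi (phaseU R S i.1 (π / 2))⁻¹)))).toLinearMap)
    neg_two_pi_I_ne_zero Complex.two_pi_I_ne_zero (am_prodCS R S) (ap_prodCR_mul_prodCS_sub_mem_span R S) (binvPi_ap R S) (binvPi_am R S)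
    N h1 (fun i v hv => hNp i v hv) (fun i v hv => hNm i v hv) ρ τ

/-- **SPAN FORM**: the same for every polynomial in the span of the balanced contraction products (= `L⁺ ⊗ L⁻` once (E-a2) says so).
[cite: Folland1989, §4.2 Prop. (4.39)] [cite: Howe1989, §3] -/
theorem binvPi_mem_of_mem_span_balanced_of_stable (N : Submodule ℂ (SchwartzMap (DPIdx P Q R S → ℝ) ℂ)) (h1 : binvPiₗ (1 : MvPolynomial (DPIdx P Q R S) ℂ) ∈ N)
    (hNp : ∀ (i : P × Q), ∀ v ∈ N,
      ((hypOpGenC R S i.1 i.2 : SchwartzMap (DPIdx P Q R S → ℝ) ℂ →L[ℂ] SchwartzMap (DPIdx P Q R S → ℝ) ℂ) -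
          I • ((unitaryOpPi (phaseU R S i.1 (π / 2))).comp ((hypOpGenC R S i.1 i.2).comp (unitaryOpPi (phaseU R S i.1 (π / 2))⁻¹)))) v ∈ N)
    (hNm : ∀ (i : P × Q), ∀ v ∈ N,
      ((hypOpGenC R S i.1 i.2 : SchwartzMap (DPIdx P Q R S → ℝ) ℂ →L[ℂ] SchwartzMap (DPIdx P Q R S → ℝ) ℂ) +
          I • ((unitaryOpPi (phaseU R S i.1 (π / 2))).comp ((hypOpGenC R S i.1 i.2).comp (unitaryOpPi (phaseU R S i.1 (π / 2))⁻¹)))) v ∈ N)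
    {F : MvPolynomial (DPIdx P Q R S) ℂ}
    (hF : F ∈ Submodule.span ℂ {x : MvPolynomial (DPIdx P Q R S) ℂ | ∃ ρ τ : List (P × Q),
      x = (ρ.map fun i : P × Q => (∑ r : R, X (Sum.inl (Sum.inl (i.1, r))) * X (Sum.inr (Sum.inr (i.2, r))) : MvPolynomial (DPIdx P Q R S) ℂ)).prod *
        (τ.map fun i : P × Q => (∑ s : S, X (Sum.inr (Sum.inl (i.1, s))) * X (Sum.inl (Sum.inr (i.2, s))) : MvPolynomial (DPIdx P Q R S) ℂ)).prod}) :
    binvPiₗ F ∈ N := by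
  have hle : Submodule.span ℂ {x : MvPolynomial (DPIdx P Q R S) ℂ | ∃ ρ τ : List (P × Q),
      x = (ρ.map fun i : P × Q => (∑ r : R, X (Sum.inl (Sum.inl (i.1, r))) * X (Sum.inr (Sum.inr (i.2, r))) : MvPolynomial (DPIdx P Q R S) ℂ)).prod *
        (τ.map fun i : P × Q => (∑ s : S, X (Sum.inr (Sum.inl (i.1, s))) * X (Sum.inl (Sum.inr (i.2, s))) : MvPolynomial (DPIdx P Q R S) ℂ)).prod} ≤
      N.comap binvPiₗ := by
    refine Submodule.span_le.2 ?_
    rintro x ⟨ρ, τ, rfl⟩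
    exact binvPi_prodCR_mul_prodCS_mem_of_stable R S N h1 hNp hNm ρ τ
  exact hle hF

/-! ## §2 The per-place step at the Fock instance (★ (E-f) with (hAm)(hAp) discharged, `B := id`) -/

omit [Fintype P] [Fintype Q] in
/-- **THE PER-PLACE STEP AT THE JUNCTION DATUM** (the `hlift` of ★ B3-core; ★ (E-f) `induction_on_kFinite` at `B := LinearMap.id` with (hAm)(hAp) from ★ (E-b) file 2):
given substitutions `subst` with (FFT) «invariant polynomials are spanned by the balanced contraction products» and a linear section map `SW` with (RED) «every `F`
has an invariant `F₀` of the same section», every property `Good` of Fock polynomials closed under `0, +, •`, under the symbols `Ap_{(p,q)}`, `Am_{(p,q)}` and under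
«same section», and holding at `1`, holds at every `F`. [cite: Howe1989, §3] [cite: KashiwaraVergne1978, §II.5] -/
theorem fock_induction_of_letters {G W : Type*} [AddCommGroup W] [Module ℂ W] (subst : G → MvPolynomial (DPIdx P Q R S) ℂ →ₗ[ℂ] MvPolynomial (DPIdx P Q R S) ℂ)
    (SW : MvPolynomial (DPIdx P Q R S) ℂ →ₗ[ℂ] W)
    (hFFT : ∀ F : MvPolynomial (DPIdx P Q R S) ℂ, (∀ g, subst g F = F) →
      F ∈ Submodule.span ℂ {x : MvPolynomial (DPIdx P Q R S) ℂ | ∃ ρ τ : List (P × Q),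
        x = (ρ.map fun i : P × Q => (∑ r : R, X (Sum.inl (Sum.inl (i.1, r))) * X (Sum.inr (Sum.inr (i.2, r))) : MvPolynomial (DPIdx P Q R S) ℂ)).prod *
          (τ.map fun i : P × Q => (∑ s : S, X (Sum.inr (Sum.inl (i.1, s))) * X (Sum.inl (Sum.inr (i.2, s))) : MvPolynomial (DPIdx P Q R S) ℂ)).prod})
    (hRED : ∀ F : MvPolynomial (DPIdx P Q R S) ℂ, ∃ F₀, (∀ g, subst g F₀ = F₀) ∧ SW F = SW F₀)
    {Good : MvPolynomial (DPIdx P Q R S) ℂ → Prop} (h0 : Good 0) (hadd : ∀ v w, Good v → Good w → Good (v + w))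
    (hsmul : ∀ (c : ℂ) v, Good v → Good (c • v)) (hbase : Good 1)
    (hAp_good : ∀ (i : P × Q) (F : MvPolynomial (DPIdx P Q R S) ℂ), Good F →
      Good ((((2 * (π : ℂ)⁻¹ * I : ℂ) • (∑ s : S, pderivLin (Sum.inr (Sum.inl (i.1, s)) : DPIdx P Q R S) ∘ₗ pderivLin (Sum.inl (Sum.inr (i.2, s)))) -
          (2 * π * I : ℂ) • LinearMap.mulLeft ℂ (∑ r : R, X (Sum.inl (Sum.inl (i.1, r))) * X (Sum.inr (Sum.inr (i.2, r))) : MvPolynomial (DPIdx P Q R S) ℂ))) F))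
    (hAm_good : ∀ (i : P × Q) (F : MvPolynomial (DPIdx P Q R S) ℂ), Good F →
      Good ((((2 * π * I : ℂ) • LinearMap.mulLeft ℂ (∑ s : S, X (Sum.inr (Sum.inl (i.1, s))) * X (Sum.inl (Sum.inr (i.2, s))) : MvPolynomial (DPIdx P Q R S) ℂ) -
        (2 * (π : ℂ)⁻¹ * I : ℂ) • ∑ r : R, pderivLin (Sum.inl (Sum.inl (i.1, r)) : DPIdx P Q R S) ∘ₗ pderivLin (Sum.inr (Sum.inr (i.2, r))))) F))
    (hsec : ∀ v v' : MvPolynomial (DPIdx P Q R S) ℂ, SW v = SW v' → Good v → Good v') (F : MvPolynomial (DPIdx P Q R S) ℂ) : Good F := by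
  have key := induction_on_kFinite
    (fun i : P × Q => (∑ r : R, X (Sum.inl (Sum.inl (i.1, r))) * X (Sum.inr (Sum.inr (i.2, r))) : MvPolynomial (DPIdx P Q R S) ℂ))
    (fun i : P × Q => (∑ s : S, X (Sum.inr (Sum.inl (i.1, s))) * X (Sum.inl (Sum.inr (i.2, s))) : MvPolynomial (DPIdx P Q R S) ℂ))
    (fun i : P × Q => ((2 * (π : ℂ)⁻¹ * I : ℂ) • (∑ s : S, pderivLin (Sum.inr (Sum.inl (i.1, s)) : DPIdx P Q R S) ∘ₗ pderivLin (Sum.inl (Sum.inr (i.2, s)))) -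
          (2 * π * I : ℂ) • LinearMap.mulLeft ℂ (∑ r : R, X (Sum.inl (Sum.inl (i.1, r))) * X (Sum.inr (Sum.inr (i.2, r))) : MvPolynomial (DPIdx P Q R S) ℂ)))
    (fun i : P × Q => ((2 * π * I : ℂ) • LinearMap.mulLeft ℂ (∑ s : S, X (Sum.inr (Sum.inl (i.1, s))) * X (Sum.inl (Sum.inr (i.2, s))) : MvPolynomial (DPIdx P Q R S) ℂ) -
        (2 * (π : ℂ)⁻¹ * I : ℂ) • ∑ r : R, pderivLin (Sum.inl (Sum.inl (i.1, r)) : DPIdx P Q R S) ∘ₗ pderivLin (Sum.inr (Sum.inr (i.2, r)))))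
    (LinearMap.id : MvPolynomial (DPIdx P Q R S) ℂ →ₗ[ℂ] MvPolynomial (DPIdx P Q R S) ℂ)
    (fun i : P × Q => ((2 * (π : ℂ)⁻¹ * I : ℂ) • (∑ s : S, pderivLin (Sum.inr (Sum.inl (i.1, s)) : DPIdx P Q R S) ∘ₗ pderivLin (Sum.inl (Sum.inr (i.2, s)))) -
          (2 * π * I : ℂ) • LinearMap.mulLeft ℂ (∑ r : R, X (Sum.inl (Sum.inl (i.1, r))) * X (Sum.inr (Sum.inr (i.2, r))) : MvPolynomial (DPIdx P Q R S) ℂ)))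
    (fun i : P × Q => ((2 * π * I : ℂ) • LinearMap.mulLeft ℂ (∑ s : S, X (Sum.inr (Sum.inl (i.1, s))) * X (Sum.inl (Sum.inr (i.2, s))) : MvPolynomial (DPIdx P Q R S) ℂ) -
        (2 * (π : ℂ)⁻¹ * I : ℂ) • ∑ r : R, pderivLin (Sum.inl (Sum.inl (i.1, r)) : DPIdx P Q R S) ∘ₗ pderivLin (Sum.inr (Sum.inr (i.2, r)))))
    subst SW neg_two_pi_I_ne_zero Complex.two_pi_I_ne_zero (am_prodCS R S) (ap_prodCR_mul_prodCS_sub_mem_span R S)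
    (fun _ _ => rfl) (fun _ _ => rfl) hFFT hRED (Good := Good) h0 hadd hsmul (by simpa using hbase)
    (fun i v hv => hAp_good i v hv) (fun i v hv => hAm_good i v hv) hsec F
  simpa using key

/-! ## §3 Generic: the subalgebra generated by two families lies in the span of the balanced products -/

section AdjoinSpan

variable {K A : Type*} [CommSemiring K] [CommSemiring A] [Algebra K A] {α β : Type*} (f : α → A) (g : β → A)

/-- **`K[f_α, g_β] ≤ span {(∏_ρ f) · (∏_τ g)}`**: in a commutative `K`-algebra, the subalgebra generated by two families `f : α → A`, `g : β → A` is contained in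
the `K`-span of the balanced products `(ρ.map f).prod * (τ.map g).prod` over words `ρ, τ` (Mathlib `Algebra.adjoin_eq_span` + sorting a word of the monoid
closure into its `f`-part and its `g`-part by commutativity). [folklore] -/
theorem adjoin_range_union_le_span_balanced :
    Subalgebra.toSubmodule (Algebra.adjoin K (Set.range f ∪ Set.range g)) ≤
      Submodule.span K {x : A | ∃ (ρ : List α) (τ : List β), x = (ρ.map f).prod * (τ.map g).prod} := by
  rw [Algebra.adjoin_eq_span]
  refine Submodule.span_mono ?_
  intro x hx
  induction hx using Submonoid.closure_induction with
  | mem y hy =>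
    rcases hy with ⟨a, rfl⟩ | ⟨b, rfl⟩
    · exact ⟨[a], [], by simp⟩
    · exact ⟨[], [b], by simp⟩
  | one => exact ⟨[], [], by simp⟩
  | mul y z _ _ hy hz =>
    obtain ⟨ρ₁, τ₁, rfl⟩ := hy
    obtain ⟨ρ₂, τ₂, rfl⟩ := hz
    exact ⟨ρ₁ ++ ρ₂, τ₁ ++ τ₂, by rw [List.map_append, List.map_append, List.prod_append, List.prod_append, mul_mul_mul_comm]⟩

/-- **membership form**: `x ∈ K[f_α, g_β] ⇒ x ∈ span {(∏_ρ f) · (∏_τ g)}`. [folklore] -/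
theorem mem_span_balanced_of_mem_adjoin {x : A} (hx : x ∈ Algebra.adjoin K (Set.range f ∪ Set.range g)) :
    x ∈ Submodule.span K {y : A | ∃ (ρ : List α) (τ : List β), y = (ρ.map f).prod * (τ.map g).prod} :=
  adjoin_range_union_le_span_balanced f g ((Subalgebra.mem_toSubmodule _).2 hx)

end AdjoinSpan

/-! ## §4 `P = Q = Fin 2`: the per-place step with (RED) discharged by ★ `hRED_of_pivot` — letters left: the pivot `hpiv` and (FFT) -/

section Pivot

open Literature.RepresentationTheory.KonnoKonno2007
open Summit.HodgeConjecture.HodgeConjecture.Cruxes.HLiu418.K2LiuLocalThetaReduction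

/-- **THE PER-PLACE STEP OF ROAD (E), MODULO THE PIVOT AND THE FFT** (`U(𝔻_σ) = U(2,2)`, any `U(R,S)`): let `SW` be a linear section functional on the one-place
Schwartz space with the see-saw pivot `SW (κOp R S e (1,k) v) = vacScalar e (1,k) • SW v` on `K_H = U(R) × U(S)`, and suppose the first fundamental theorem in
the form «a Fock polynomial invariant under the substitutions `linSubst (star ↑(dualPairι (1,k)))` lies in `ℂ[C^R_{pq}, C^S_{pq}]`».  Then every property `Good` of
Fock polynomials closed under `0, +, •`, under the `𝔭^±` symbols `Ap_{(p,q)}`, `Am_{(p,q)}` (★ (E-b) file 2's explicit terms) and under «same section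
`SW (binvPi v) = SW (binvPi v′)`», and holding at the vacuum polynomial `1`, holds at EVERY `F` — ★ `fock_induction_of_letters` at
`subst k := (linSubst (star ↑(dualPairι (1,k)))).toLinearMap`, `SW ∘ₗ binvPiₗ`, with (RED) := ★ `hRED_of_pivot` and the span letter := §3 ∘ `hFFT`.
[cite: Howe1989, §3] [cite: Folland1989, Prop. (4.39)] [cite: KashiwaraVergne1978, §II.5] -/
theorem fock_induction_of_pivot (e : VacExponents) {W : Type*} [AddCommGroup W] [Module ℂ W]
    (SW : SchwartzMap (DPIdx (Fin 2) (Fin 2) R S → ℝ) ℂ →ₗ[ℂ] W)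
    (hpiv : ∀ (k : Matrix.unitaryGroup R ℂ × Matrix.unitaryGroup S ℂ) (v : SchwartzMap (DPIdx (Fin 2) (Fin 2) R S → ℝ) ℂ),
      SW (κOp R S e ((1, k) : DPK (Fin 2) (Fin 2) R S) v) = vacScalar e ((1, k) : DPK (Fin 2) (Fin 2) R S) • SW v)
    (hFFT : ∀ F : MvPolynomial (DPIdx (Fin 2) (Fin 2) R S) ℂ,
      (∀ k : Matrix.unitaryGroup R ℂ × Matrix.unitaryGroup S ℂ,
        linSubst (star ((dualPairι ((1, k) : DPK (Fin 2) (Fin 2) R S) : Matrix.unitaryGroup (DPIdx (Fin 2) (Fin 2) R S) ℂ) :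
          Matrix (DPIdx (Fin 2) (Fin 2) R S) (DPIdx (Fin 2) (Fin 2) R S) ℂ)) F = F) →
      F ∈ Algebra.adjoin ℂ
        (Set.range (fun i : Fin 2 × Fin 2 => (∑ r : R, X (Sum.inl (Sum.inl (i.1, r))) * X (Sum.inr (Sum.inr (i.2, r))) : MvPolynomial (DPIdx (Fin 2) (Fin 2) R S) ℂ)) ∪
          Set.range (fun i : Fin 2 × Fin 2 => (∑ s : S, X (Sum.inr (Sum.inl (i.1, s))) * X (Sum.inl (Sum.inr (i.2, s))) : MvPolynomial (DPIdx (Fin 2) (Fin 2) R S) ℂ))))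
    {Good : MvPolynomial (DPIdx (Fin 2) (Fin 2) R S) ℂ → Prop} (h0 : Good 0) (hadd : ∀ v w, Good v → Good w → Good (v + w))
    (hsmul : ∀ (c : ℂ) v, Good v → Good (c • v)) (hbase : Good 1)
    (hAp_good : ∀ (i : Fin 2 × Fin 2) (F : MvPolynomial (DPIdx (Fin 2) (Fin 2) R S) ℂ), Good F →
      Good ((((2 * (π : ℂ)⁻¹ * I : ℂ) • (∑ s : S, pderivLin (Sum.inr (Sum.inl (i.1, s)) : DPIdx (Fin 2) (Fin 2) R S) ∘ₗ pderivLin (Sum.inl (Sum.inr (i.2, s)))) -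
          (2 * π * I : ℂ) • LinearMap.mulLeft ℂ (∑ r : R, X (Sum.inl (Sum.inl (i.1, r))) * X (Sum.inr (Sum.inr (i.2, r))) : MvPolynomial (DPIdx (Fin 2) (Fin 2) R S) ℂ))) F))
    (hAm_good : ∀ (i : Fin 2 × Fin 2) (F : MvPolynomial (DPIdx (Fin 2) (Fin 2) R S) ℂ), Good F →
      Good ((((2 * π * I : ℂ) • LinearMap.mulLeft ℂ (∑ s : S, X (Sum.inr (Sum.inl (i.1, s))) * X (Sum.inl (Sum.inr (i.2, s))) : MvPolynomial (DPIdx (Fin 2) (Fin 2) R S) ℂ) -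
        (2 * (π : ℂ)⁻¹ * I : ℂ) • ∑ r : R, pderivLin (Sum.inl (Sum.inl (i.1, r)) : DPIdx (Fin 2) (Fin 2) R S) ∘ₗ pderivLin (Sum.inr (Sum.inr (i.2, r))))) F))
    (hsec : ∀ v v' : MvPolynomial (DPIdx (Fin 2) (Fin 2) R S) ℂ, SW (binvPi v) = SW (binvPi v') → Good v → Good v')
    (F : MvPolynomial (DPIdx (Fin 2) (Fin 2) R S) ℂ) : Good F :=
  fock_induction_of_letters R S
    (fun k : Matrix.unitaryGroup R ℂ × Matrix.unitaryGroup S ℂ =>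
      (linSubst (star ((dualPairι ((1, k) : DPK (Fin 2) (Fin 2) R S) : Matrix.unitaryGroup (DPIdx (Fin 2) (Fin 2) R S) ℂ) :
        Matrix (DPIdx (Fin 2) (Fin 2) R S) (DPIdx (Fin 2) (Fin 2) R S) ℂ))).toLinearMap)
    (SW ∘ₗ binvPiₗ)
    (fun F hF => mem_span_balanced_of_mem_adjoin _ _ (hFFT F fun k => by simpa only [AlgHom.toLinearMap_apply] using hF k))
    (fun F => by
      obtain ⟨F₀, h1, h2⟩ := hRED_of_pivot e SW hpiv F
      exact ⟨F₀, fun k => by rw [AlgHom.toLinearMap_apply]; exact h1 k, by simpa only [LinearMap.comp_apply, binvPiₗ_apply] using h2⟩)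
    h0 hadd hsmul hbase hAp_good hAm_good
    (fun v v' h => hsec v v' (by simpa only [LinearMap.comp_apply, binvPiₗ_apply] using h)) F

end Pivot

/-! ## §5 `P = Q = Fin 2`: (FFT) down to the two block letters of ★ the bridge — residue `hR`, `hS`, `hpiv` -/

section BlockFFT

open Literature.RepresentationTheory.KonnoKonno2007
open Summit.HodgeConjecture.HodgeConjecture.Cruxes.HLiu418.K2LiuLocalThetaReduction
open Summit.HodgeConjecture.HodgeConjecture.Cruxes.HLiu418.K2LiuFockInvariantsOfBlocks

/-- **THE PER-PLACE STEP OF ROAD (E), MODULO THE PIVOT AND THE TWO BLOCK FFTs**: as `fock_induction_of_pivot`, with the first fundamental theorem supplied by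
★ K2Liu-p23's bridge `fft_fock_of_fft_blocks_prod` from the two BLOCK letters — `hR`: a polynomial in the `R`-block variables `x_{(p,r)}, y_{(q,r)}` invariant under
`c ∈ U(R)` (`x ↦ x·c`, `y ↦ y·c̄`) lies in `ℂ[Σ_r x_{(p,r)} y_{(q,r)}]`, and `hS`: the same on the `S`-block (both = ★ `K2LiuUnitaryFFTContractions.isUnitaryInvariant_iff_mem_adjoin`
up to p23's reindexing).  Residue by value: `hR`, `hS`, `hpiv`. [cite: Howe1989, §3] [cite: Weyl1939, Thm. 2.6.A] [cite: Folland1989, Prop. (4.39)] -/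
theorem fock_induction_of_blockFFT_of_pivot (e : VacExponents) {W : Type*} [AddCommGroup W] [Module ℂ W]
    (SW : SchwartzMap (DPIdx (Fin 2) (Fin 2) R S → ℝ) ℂ →ₗ[ℂ] W)
    (hpiv : ∀ (k : Matrix.unitaryGroup R ℂ × Matrix.unitaryGroup S ℂ) (v : SchwartzMap (DPIdx (Fin 2) (Fin 2) R S → ℝ) ℂ),
      SW (κOp R S e ((1, k) : DPK (Fin 2) (Fin 2) R S) v) = vacScalar e ((1, k) : DPK (Fin 2) (Fin 2) R S) • SW v)
    (hR : ∀ f : MvPolynomial ((Fin 2 × R) ⊕ (Fin 2 × R)) ℂ,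
      (∀ c : Matrix.unitaryGroup R ℂ, aeval (Sum.elim (fun pr : Fin 2 × R => ∑ b : R, X (Sum.inl (pr.1, b)) * C ((c : Matrix R R ℂ) b pr.2))
          (fun qr : Fin 2 × R => ∑ b : R, X (Sum.inr (qr.1, b)) * C ((star (c : Matrix R R ℂ)) qr.2 b)) :
            (Fin 2 × R) ⊕ (Fin 2 × R) → MvPolynomial ((Fin 2 × R) ⊕ (Fin 2 × R)) ℂ) f = f) →
        f ∈ Algebra.adjoin ℂ (Set.range fun ij : Fin 2 × Fin 2 =>
          (∑ r : R, X (Sum.inl (ij.1, r)) * X (Sum.inr (ij.2, r)) : MvPolynomial ((Fin 2 × R) ⊕ (Fin 2 × R)) ℂ)))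
    (hS : ∀ g : MvPolynomial ((Fin 2 × S) ⊕ (Fin 2 × S)) ℂ,
      (∀ d : Matrix.unitaryGroup S ℂ, aeval (Sum.elim (fun pr : Fin 2 × S => ∑ b : S, X (Sum.inl (pr.1, b)) * C ((d : Matrix S S ℂ) b pr.2))
          (fun qr : Fin 2 × S => ∑ b : S, X (Sum.inr (qr.1, b)) * C ((star (d : Matrix S S ℂ)) qr.2 b)) :
            (Fin 2 × S) ⊕ (Fin 2 × S) → MvPolynomial ((Fin 2 × S) ⊕ (Fin 2 × S)) ℂ) g = g) →
        g ∈ Algebra.adjoin ℂ (Set.range fun ij : Fin 2 × Fin 2 =>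
          (∑ s : S, X (Sum.inl (ij.2, s)) * X (Sum.inr (ij.1, s)) : MvPolynomial ((Fin 2 × S) ⊕ (Fin 2 × S)) ℂ)))
    {Good : MvPolynomial (DPIdx (Fin 2) (Fin 2) R S) ℂ → Prop} (h0 : Good 0) (hadd : ∀ v w, Good v → Good w → Good (v + w))
    (hsmul : ∀ (c : ℂ) v, Good v → Good (c • v)) (hbase : Good 1)
    (hAp_good : ∀ (i : Fin 2 × Fin 2) (F : MvPolynomial (DPIdx (Fin 2) (Fin 2) R S) ℂ), Good F →
      Good ((((2 * (π : ℂ)⁻¹ * I : ℂ) • (∑ s : S, pderivLin (Sum.inr (Sum.inl (i.1, s)) : DPIdx (Fin 2) (Fin 2) R S) ∘ₗ pderivLin (Sum.inl (Sum.inr (i.2, s)))) -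
          (2 * π * I : ℂ) • LinearMap.mulLeft ℂ (∑ r : R, X (Sum.inl (Sum.inl (i.1, r))) * X (Sum.inr (Sum.inr (i.2, r))) : MvPolynomial (DPIdx (Fin 2) (Fin 2) R S) ℂ))) F))
    (hAm_good : ∀ (i : Fin 2 × Fin 2) (F : MvPolynomial (DPIdx (Fin 2) (Fin 2) R S) ℂ), Good F →
      Good ((((2 * π * I : ℂ) • LinearMap.mulLeft ℂ (∑ s : S, X (Sum.inr (Sum.inl (i.1, s))) * X (Sum.inl (Sum.inr (i.2, s))) : MvPolynomial (DPIdx (Fin 2) (Fin 2) R S) ℂ) -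
        (2 * (π : ℂ)⁻¹ * I : ℂ) • ∑ r : R, pderivLin (Sum.inl (Sum.inl (i.1, r)) : DPIdx (Fin 2) (Fin 2) R S) ∘ₗ pderivLin (Sum.inr (Sum.inr (i.2, r))))) F))
    (hsec : ∀ v v' : MvPolynomial (DPIdx (Fin 2) (Fin 2) R S) ℂ, SW (binvPi v) = SW (binvPi v') → Good v → Good v')
    (F : MvPolynomial (DPIdx (Fin 2) (Fin 2) R S) ℂ) : Good F :=
  fock_induction_of_letters R S
    (fun k : Matrix.unitaryGroup R ℂ × Matrix.unitaryGroup S ℂ =>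
      (linSubst (star ((dualPairι ((1, k) : DPK (Fin 2) (Fin 2) R S) : Matrix.unitaryGroup (DPIdx (Fin 2) (Fin 2) R S) ℂ) :
        Matrix (DPIdx (Fin 2) (Fin 2) R S) (DPIdx (Fin 2) (Fin 2) R S) ℂ))).toLinearMap)
    (SW ∘ₗ binvPiₗ)
    (fun F hF => fft_fock_of_fft_blocks_prod hR hS F hF)
    (fun F => by
      obtain ⟨F₀, h1, h2⟩ := hRED_of_pivot e SW hpiv F
      exact ⟨F₀, fun k => by rw [AlgHom.toLinearMap_apply]; exact h1 k, by simpa only [LinearMap.comp_apply, binvPiₗ_apply] using h2⟩)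
    h0 hadd hsmul hbase hAp_good hAm_good
    (fun v v' h => hsec v v' (by simpa only [LinearMap.comp_apply, binvPiₗ_apply] using h)) F

end BlockFFT

end Summit.HodgeConjecture.HodgeConjecture.Cruxes.HLiu418.K2LiuArchSWPlaceCyclic

end
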